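import Literature.NumberTheory.IwasawaTheory.ClassicalMuVanishesNonsplitCartanFiveDescent
import Literature.NumberTheory.SerreUniformity.Statement
import Mathlib.GroupTheory.Perm.Cycle.Type
import HarnessLib

set_option autoImplicit false

/-!
# `μ = 0` for a Galois number field with a faithful representation onto `C_ns⁺(5)`: the bridge from matrices over `𝔽₅`
# to the `C₂₄ ⋊ C₂` census form

Topic `NumberTheory/IwasawaTheory` (namespace = path).  THEOREM-ONLY file (no definition, no named fact, no `sorry`); literature
seat `bsd-potss-conjA-anchor` g12 (supports stmt-BirchSwinnertonDyer-19413; closes nothing).  Companion of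
`ClassicalMuVanishesNonsplitCartanFiveDescent.lean`, in the vocabulary of `SerreUniformity.nonsplitCartanNormalizer ε` (matrices
`(a εb; b a)` and `(a −εb; b −a)` over `𝔽₅`, `ε` a non-square, i.e. `ε ∈ {2, 3}`):

* `classicalMuVanishes_of_isCyclotomic_of_nonsplitCartanNormalizer_five_fixedField` — `L/ℚ` Galois, `ρ : Gal(L/ℚ) →* M₂(𝔽₅)`
  INJECTIVE with values in `C_ns⁺(ε)`, `x, s ∈ Gal(L/ℚ)` with `ρ x = R_ε := (1 ε(4−ε); 4−ε 1)` (a generator of `C_ns(ε) ≅ 𝔽₂₅ˣ`: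
  `1 + 2√2` resp. `1 + √3`) and `ρ s = S := diag(1, −1)`: then `x²⁴ = 1`, `s² = 1`, `s x s⁻¹ = x⁵` and `5 ∤ [L:ℚ]` (every element of
  `C_ns⁺(ε)` has order dividing `24`), so the census form `classicalMuVanishes_of_isCyclotomic_of_nonsplitCartanFive_kuroda_rat` applies:
  «`μ = 0` for every cyclotomic `ℤ₅`-extension» of the seven fixed fields `L^{⟨s⟩}` (`= ℚ(P)` for `L = ℚ(E[5])`), `L^{⟨x¹²,s⟩}`,
  `L^{⟨x⁶s⟩}`, `L^{⟨x³⟩}`, `L^{⟨x⁶,s⟩}`, `L^{⟨x⁶,x³s⟩}`, `L^{⟨x³,s⟩}` gives the same for `L`.  NO named fact is used.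
Group facts by `decide` on explicit matrices: `R_ε²⁴ = 1` (as `(R_ε⁸)³`), `S² = 1`, `S R_ε S = R_ε⁵`, `A²⁴ = 1` on `C_ns(ε)` and `A⁸ = 1` on
the other coset; the non-squares of `𝔽₅` are `2, 3`.

References: [Serre1972, §2.2]; [FurioLombardo2023, (1.1)]; [Lemmermeyer1994, §1]; [Washington1997, §13.1].
-/

noncomputable section

open scoped NumberField

open Field IntermediateField Literature.NumberTheory.EllipticCurves Literature.NumberTheory.SerreUniformity

namespace Literature.NumberTheory.IwasawaTheory

/-! ### §0 Finite facts about `C_ns⁺(5)`, by `decide` -/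

section Matrices

/-- `R₂ = (1 4; 2 1) = 1 + 2√2 ∈ 𝔽₅(√2)ˣ`: `(R₂⁸)³ = 1`, `S R₂ S = R₂⁵`, `S = diag(1,−1)`. [folklore] -/
private theorem R2_facts :
    (((!![1, 4; 2, 1] : Matrix (Fin 2) (Fin 2) (ZMod 5)) ^ 8) ^ 3 = 1) ∧
    ((!![1, 0; 0, 4] : Matrix (Fin 2) (Fin 2) (ZMod 5)) * !![1, 4; 2, 1] * !![1, 0; 0, 4] =
      (!![1, 4; 2, 1] : Matrix (Fin 2) (Fin 2) (ZMod 5)) ^ 5) := by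
  decide

/-- `R₃ = (1 3; 1 1) = 1 + √3 ∈ 𝔽₅(√3)ˣ`: `(R₃⁸)³ = 1`, `S R₃ S = R₃⁵`. [folklore] -/
private theorem R3_facts :
    (((!![1, 3; 1, 1] : Matrix (Fin 2) (Fin 2) (ZMod 5)) ^ 8) ^ 3 = 1) ∧
    ((!![1, 0; 0, 4] : Matrix (Fin 2) (Fin 2) (ZMod 5)) * !![1, 3; 1, 1] * !![1, 0; 0, 4] =
      (!![1, 3; 1, 1] : Matrix (Fin 2) (Fin 2) (ZMod 5)) ^ 5) := by
  decide

/-- `S² = 1`. [folklore] -/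
private theorem S_sq : (!![1, 0; 0, 4] : Matrix (Fin 2) (Fin 2) (ZMod 5)) * !![1, 0; 0, 4] = 1 := by
  decide

/-- Orders in `C_ns(2) ≅ 𝔽₂₅ˣ` divide `24`. [folklore] -/
private theorem c2_pow : ∀ a b : ZMod 5, (a, b) ≠ (0, 0) →
    ((!![a, 2 * b; b, a] : Matrix (Fin 2) (Fin 2) (ZMod 5)) ^ 8) ^ 3 = 1 := by
  decide

/-- Orders in `C_ns(3) ≅ 𝔽₂₅ˣ` divide `24`. [folklore] -/
private theorem c3_pow : ∀ a b : ZMod 5, (a, b) ≠ (0, 0) →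
    ((!![a, 3 * b; b, a] : Matrix (Fin 2) (Fin 2) (ZMod 5)) ^ 8) ^ 3 = 1 := by
  decide

/-- Orders in `C_ns⁺(2) ∖ C_ns(2)` divide `8`. [folklore] -/
private theorem n2_pow : ∀ a b : ZMod 5, (a, b) ≠ (0, 0) →
    ((!![a, -(2 * b); b, -a] : Matrix (Fin 2) (Fin 2) (ZMod 5))) ^ 8 = 1 := by
  decide

/-- Orders in `C_ns⁺(3) ∖ C_ns(3)` divide `8`. [folklore] -/
private theorem n3_pow : ∀ a b : ZMod 5, (a, b) ≠ (0, 0) →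
    ((!![a, -(3 * b); b, -a] : Matrix (Fin 2) (Fin 2) (ZMod 5))) ^ 8 = 1 := by
  decide

/-- Every element of `C_ns⁺(ε)`, `ε ∈ {2, 3}`, has order dividing `24`. [folklore] -/
private theorem pow_24_eq_one_of_mem {ε : ZMod 5} (hε : ε = 2 ∨ ε = 3) {A : Matrix (Fin 2) (Fin 2) (ZMod 5)}
    (hA : A ∈ nonsplitCartanNormalizer ε) : A ^ 24 = 1 := by
  obtain ⟨a, b, hab, rfl | rfl⟩ := hA
  · rw [show (24 : ℕ) = 8 * 3 by norm_num, pow_mul]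
    rcases hε with rfl | rfl
    exacts [c2_pow a b hab, c3_pow a b hab]
  · rw [show (24 : ℕ) = 8 * 3 by norm_num, pow_mul]
    rcases hε with rfl | rfl
    · rw [n2_pow a b hab, one_pow]
    · rw [n3_pow a b hab, one_pow]

/-- The non-squares of `𝔽₅` are `2` and `3`. [folklore] -/
private theorem eq_two_or_three_of_not_isSquare {ε : ZMod 5} (hε : ¬ IsSquare ε) : ε = 2 ∨ ε = 3 := by
  have key : ∀ e : ZMod 5, e = 0 ∨ e = 1 ∨ e = 4 ∨ e = 2 ∨ e = 3 := by decide
  rcases key ε with h | h | h | h | h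
  · exact absurd ⟨0, by rw [h, mul_zero]⟩ hε
  · exact absurd ⟨1, by rw [h, mul_one]⟩ hε
  · exact absurd ⟨2, by rw [h]; decide⟩ hε
  · exact Or.inl h
  · exact Or.inr h

/-- The generator `R_ε = (1 ε(4−ε); 4−ε 1)` for `ε ∈ {2,3}`: `(R_ε⁸)³ = 1` and `S R_ε S = R_ε⁵`. [folklore] -/
private theorem R_facts {ε : ZMod 5} (hε : ε = 2 ∨ ε = 3) :
    (((!![1, ε * (4 - ε); 4 - ε, 1] : Matrix (Fin 2) (Fin 2) (ZMod 5)) ^ 8) ^ 3 = 1) ∧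
    ((!![1, 0; 0, 4] : Matrix (Fin 2) (Fin 2) (ZMod 5)) * !![1, ε * (4 - ε); 4 - ε, 1] * !![1, 0; 0, 4] =
      (!![1, ε * (4 - ε); 4 - ε, 1] : Matrix (Fin 2) (Fin 2) (ZMod 5)) ^ 5) := by
  rcases hε with rfl | rfl
  · have h1 : (!![1, 2 * (4 - 2); 4 - 2, 1] : Matrix (Fin 2) (Fin 2) (ZMod 5)) = !![1, 4; 2, 1] := by decide
    rw [h1]; exact R2_facts
  · have h1 : (!![1, 3 * (4 - 3); 4 - 3, 1] : Matrix (Fin 2) (Fin 2) (ZMod 5)) = !![1, 3; 1, 1] := by decide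
    rw [h1]; exact R3_facts

end Matrices

/-! ### §1 The bridge -/

/-- **`μ = 0` for `L` from a faithful `C_ns⁺(5)`-valued representation and seven fixed fields (fact-free).**  `L/ℚ` finite Galois,
`ρ : Gal(L/ℚ) →* M₂(𝔽₅)` injective with values in `nonsplitCartanNormalizer ε` (`ε` a non-square), `x, s ∈ Gal(L/ℚ)` with
`ρ x = (1 ε(4−ε); 4−ε 1)` (a generator of `C_ns(ε)`) and `ρ s = diag(1, −1)`.  Then `x²⁴ = 1`, `s² = 1`, `s x s⁻¹ = x⁵`, `5 ∤ [L : ℚ]`,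
and «`μ = 0` for every cyclotomic `ℤ₅`-extension» of the fixed fields of `⟨s⟩`, `⟨x¹², s⟩`, `⟨x⁶s⟩`, `⟨x³⟩`, `⟨x⁶, s⟩`, `⟨x⁶, x³s⟩`,
`⟨x³, s⟩` gives the same for `L` (`classicalMuVanishes_of_isCyclotomic_of_nonsplitCartanFive_kuroda_rat`).  For `L = ℚ(E[5])` with
`HasModPImageEqNonsplitCartanNormalizer E 5`: `L^{⟨s⟩} = ℚ(P)` (degree 24, `P` the first basis vector), the other six of degrees
12, 12, 6, 6, 6, 3.  NO named fact. [cite: Serre1972, §2.2 (non-split Cartan subgroups and their normalisers)]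
[cite: Lemmermeyer1994, §1 (Kuroda's class number formula, odd part)] [cite: Washington1997, §13.1] -/
theorem classicalMuVanishes_of_isCyclotomic_of_nonsplitCartanNormalizer_five_fixedField [Fact (Nat.Prime 5)]
    (L : Type) [Field L] [NumberField L] [IsGalois ℚ L] {ε : ZMod 5} (hε : ¬ IsSquare ε)
    (ρ : (L ≃ₐ[ℚ] L) →* Matrix (Fin 2) (Fin 2) (ZMod 5)) (hρ : Function.Injective ρ)
    (himg : ∀ g, ρ g ∈ nonsplitCartanNormalizer ε) {x s : L ≃ₐ[ℚ] L}
    (hρx : ρ x = !![1, ε * (4 - ε); 4 - ε, 1]) (hρs : ρ s = !![1, 0; 0, 4])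
    (hμP : ∀ κE : ZpExtension ↥(fixedField (Subgroup.zpowers s)) 5, κE.IsCyclotomic → ClassicalMuVanishes κE)
    (hμB₁ : ∀ κE : ZpExtension ↥(fixedField (Subgroup.zpowers (x ^ 12) ⊔ Subgroup.zpowers s)) 5,
      κE.IsCyclotomic → ClassicalMuVanishes κE)
    (hμB₁' : ∀ κE : ZpExtension ↥(fixedField (Subgroup.zpowers (x ^ 6 * s))) 5, κE.IsCyclotomic → ClassicalMuVanishes κE)
    (hμS : ∀ κE : ZpExtension ↥(fixedField (Subgroup.zpowers (x ^ 3))) 5, κE.IsCyclotomic → ClassicalMuVanishes κE)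
    (hμB₂ : ∀ κE : ZpExtension ↥(fixedField (Subgroup.zpowers (x ^ 6) ⊔ Subgroup.zpowers s)) 5,
      κE.IsCyclotomic → ClassicalMuVanishes κE)
    (hμB₂' : ∀ κE : ZpExtension ↥(fixedField (Subgroup.zpowers (x ^ 6) ⊔ Subgroup.zpowers (x ^ 3 * s))) 5,
      κE.IsCyclotomic → ClassicalMuVanishes κE)
    (hμB₃ : ∀ κE : ZpExtension ↥(fixedField (Subgroup.zpowers (x ^ 3) ⊔ Subgroup.zpowers s)) 5,
      κE.IsCyclotomic → ClassicalMuVanishes κE)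
    (κL : ZpExtension L 5) (hκL : κL.IsCyclotomic) : ClassicalMuVanishes κL := by
  classical
  have hε' := eq_two_or_three_of_not_isSquare hε
  obtain ⟨fR24, fSRS⟩ := R_facts hε'
  -- relations among `x, s`
  have hx : x ^ 24 = 1 := hρ (by rw [map_pow, hρx, map_one, show (24 : ℕ) = 8 * 3 by norm_num, pow_mul]; exact fR24)
  have hs : s * s = 1 := hρ (by rw [map_mul, hρs, S_sq, map_one])
  have hsinv : s⁻¹ = s := inv_eq_of_mul_eq_one_right hs
  have hsx : s * x * s⁻¹ = x ^ 5 := by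
    rw [hsinv]
    exact hρ (by rw [map_mul, map_mul, map_pow, hρs, hρx]; exact fSRS)
  -- `5 ∤ [L : ℚ]`: every `g` has `g²⁴ = 1`
  have h24 : ∀ g : L ≃ₐ[ℚ] L, g ^ 24 = 1 := fun g =>
    hρ (by rw [map_pow, map_one]; exact pow_24_eq_one_of_mem hε' (himg g))
  have hp : ¬ 5 ∣ Module.finrank ℚ L := by
    intro h5
    rw [← IsGalois.card_aut_eq_finrank, Nat.card_eq_fintype_card] at h5
    obtain ⟨g, hg⟩ := exists_prime_orderOf_dvd_card 5 h5
    have h1 : orderOf g ∣ 24 := orderOf_dvd_of_pow_eq_one (h24 g)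
    rw [hg] at h1
    exact absurd h1 (by norm_num)
  exact classicalMuVanishes_of_isCyclotomic_of_nonsplitCartanFive_kuroda_rat (p := 5) (by norm_num) L hp hx hs hsx
    hμP hμB₁ hμB₁' hμS hμB₂ hμB₂' hμB₃ κL hκL

end Literature.NumberTheory.IwasawaTheory

end
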